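import Summits.BirchSwinnertonDyer.Rank1Residual.O6.KatoLocalFloor
import HarnessLib

/-!
# BSD rank-≤1 residual cell, class O6 (WILD `p = 3`), Iwasawa side: T-O6-G12, ANALYTIC HALF — (A) the KATO BRIDGE
# `ν ≥ 𝔪 − v₃(c_W)` (KL-a, theorem-candidate conditional on Kato's integrality), (B) the REFINED-BSD / SELMER-LENGTH
# shape `φ(3^k)(ν − 𝔪) ∈ ℤ_{≥0}` (KL-b), (AN) the ANALYTIC CELL LAW `φ(3^k)(ν − ℓ(cell)) ∈ ℤ_{≥ a_min}` — TYPED,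
# EVIDENCE-LABELLED, NOTHING ASSERTED (sibling of `O6/KatoLocalFloor.lean`, which holds the interface and the
# local laws (M) (Λ) (IRR) (TW) (CAN); same ask, same provenance)

HONEST FRAMING (cell `b2b-bsdres`, run/shared/lean/b2b/bsd-rank1-residual/, verbatim in every file): the goal of
the cell is to DELETE the COMBINATION-SHAPED residual classes of the Birch–Swinnerton-Dyer formula for ALL
analytic-rank `≤ 1` elliptic curves over `ℚ` — assembled STRICTLY from published theorems — so that the rank-`≤ 1`
remainder becomes exactly the CONSTRUCTION-SHAPED classes, which are TYPED (missing-input `Prop`s), NOT attempted.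
This is not "finishing BSD". Lane CLASS-CLOSURE (`CLASS-CLOSURE-PLAN.md` §3.4 O6, deliverable (a) STATEMENT
DISCOVERY with HELD-OUT validation; o6-r1's FIRST EXPERIMENT of record for these three laws is P-AN4 — analytic
`ν` on the frozen 120-curve KF4 set, pre-registered `HOME/b2b-bsdres-o6-r1/gen12/an/PAN4-PREREG.md` sha16
`0b97ff514250650c`, NOT yet run: the held-out test of (A)/(B)/(AN) is PENDING, the in-sample evidence is below):
research routes; no claim beyond the stated classes; census output is EVIDENCE / conjecture items, never a Literature
fact; no main conjecture, no `p`-adic `L`-function, no Coleman map is assumed (N-O6-CF, o6-r1 gen 10: none of bounded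
depth exists); Kato's integrality enters ONLY as the explicit interface hypothesis `KatoIntegralAtThree W` (a section
variable like `KMC` in `Additive/FouquetWanLocus.lean` — no named fact is minted; lit-kato's
`Kato2004.conj12_10_iff_conj17_6_of_skeleton` / a `KatoZetaSkeleton` would instantiate it); nothing is booked; no
mark of `RESIDUAL-MAP.md` moves; O6 stays OPEN. 0 Literature facts.

## What is typed (cc-typer-5 GEN 10; ask of o6-r1 GEN 12, `HOME/INBOX.md` 2026-08-21T19:43:40Z; content = memo of
## record `gen12/O6-GEN12.md` b74dc3c6d65d6ac1 §2 (ANALYTIC RE-READ), §5 (A) (B) (AN); schema `gen12/lean/O6KatoLocalFloorG12b.lean`)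

Over the interface `SignedFloorDatum W` (`nu k s = ν^s_k(W)` = the `3`-adic valuation of the `χ_s`-part of the
Mazur–Tate element `θ_{k+1}(W)`, `pos k s = n^s_k(W)`, `katoConst = v₃(c_W)`, `shape`, `torsThree`) and its `real`
predicate:
* (A) `KatoLocalFloorBoundThree` — `ν^s_k(W) ≥ 𝔪^s_k(W) − v₃(c_W)` given Kato's integrality of the zeta element at `3`
  (THEOREM-CANDIDATE: `𝔪` is BY CONSTRUCTION the minimum of `v₃ R_χ` over the dual lattice `L_k^* = exp*(H¹)`, and
  `exp*` of an integral zeta element lies in `c_W^{-1} L_k^*`; Kato Thm 12.5 + explicit reciprocity). KL-a.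
* (B) `SelmerLengthLawThree` — `φ(3^k)·(ν − 𝔪) ∈ ℤ_{≥ 0}` (conjecturally `= length_{𝒪_χ} Sel_{χ_s}(W/K_k)` with the
  TRACE-FREE local condition at `3` — Kurihara Rem. 1.3 / Mazur–Tate shape; "`ν = 𝔪` ⟺ no `χ`-Selmer"). KL-b.
* (AN) `AnalyticCellLawThree` — for `k ≥ 2`: `a^s_k := φ(3^k)·(ν − ℓ(cell)) ∈ ℤ`, `a ≥ a_min(shape, s, k)` with
  `a_min = 1` on the `−s_T` side of ET1/ORD1, `⌊(3^{k−1} − 1)/4⌋` for IRR, `0` otherwise (`analyticMin`) — the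
  cell-uniform statement "`v₃(L(W,χ,1)/Ω) ≥ ℓ(v₃N, Kod₃) + a_min/φ` for EVERY `χ` of conductor `3^{k+1}`, `k ≥ 2`,
  with NO curve-dependent loss", the one the census can test curve by curve. **REFUTED-AS-STATED on its own
  pre-registered held-out P-AN4 (clause AN-1, scored 2026-08-21T21:16Z) and WITHDRAWN as a node: kept below
  VERBATIM as a tombstone WITHOUT the `@[conjecture]` tag (see `## VERDICT STATUS`).**

## VERDICT STATUS (cc-typer-5 GEN 10 restamp 1, 2026-08-21T23:15Z — o6-r1 GEN 13 VERDICT ADDENDUM,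
## `CLASS-CLOSURE-PLAN.md` §3.4 l.210, memo `HOME/b2b-bsdres-o6-r1/gen13/O6-GEN13.md` §4; statements byte-identical)

P-AN4 = the gen-12 analytic HELD-OUT (prereg `gen12/an/PAN4-PREREG.md` 0b97ff514250650c; frozen scorer
`gen13/pan4/pan4_verdict.py` 2fd0355ab5aaeb4a stamped before outputs; kit j139543 / j139549 / j139558 / j139567 = the 120
KF4 curves, `k ≤ 3`, 474 finite signed rows + 6 vanishing) ⇒ **KILL on AN-1**: `a^s_k ∈ ℤ_{≥0}` holds on 464/474 only —
TEN violations, all `a = −1`, on FIVE curves × (`k = 2, 3`): 10098b1 (3,II) SPLIT `s = +`; 10530a1 (4,II) ET1 `s = +`;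
10692f1 (5,II) ORD1 `s = −`; 11178b1, 11178e1 (5,IV) ET1 `s = +` — every violation on the TORSION side `s = s_T` of a
T-shape or on a SPLIT curve, exactly one unit (the in-sample "T.tors `a = −1`" rows the gen-12 registration excluded by
demanding `a ≥ 0` universally). VERDICT AS REGISTERED (o6-r1): the analytic LEVEL LAW (AN) is REFUTED AS STATED
(class: misstated; 5 named witnesses); the repaired reading "`a ≥ −1` on the `s_T` side of ET1/ORD1 and on SPLIT,
`a ≥ 0` otherwise" holds 474/474 but is POST-HOC and goes to a gen-14 PRE-REGISTRATION on fresh conductors (KF4 spent)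
— it is NOT typed here. **AN-2 (the B-facing inequality `d^s_k := φ(3^k)(ν − 𝔪^s_k) ≥ 0`: analytic valuation ≥ the
Kato-local floor of the SAME curve) 474/474 = PASS** — "the clause a certificate would use": HELD-OUT support for (B)'s
non-negativity and hence for (A); AN-3 (analytic shape law at `k = 3`) PASS; AN-5 exactness below expectation (`a = a_min`
44 %, `d = 0` 40 %; sharpness is not a law); AN-6: 6 vanishing rows at `k = 2`, none at `k = 3`. BOOKING: EVIDENCE only;
nothing else moves; O6 OPEN. LANE RULE (no refuted statement is an obligation node; tree rule "deprecate, don't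
mutate", idiom of `O5/O5GrowthLaws.lean` T10): `AnalyticCellLawThree` is kept verbatim, its docstring marked WITHDRAWN,
the tag DROPPED, its bookkeeping corollary `cellLevel_le_nu_of_analyticCellLaw` tagged `@[deprecated]`; (A), (B) keep
their tags with the held-out line added.
* §3 worked rows of the memo as kernel arithmetic on `floorOf` / `lamOf` (no datum): cell `(4, II*)`, `k = 3`,
  `n = −16` ⇒ `𝔪 = 25/18`, `λ = 1`; IRR `(3, II)`, `k = 4`, `n = −7 / −6` ⇒ `λ = 7 / 6`, sum `13 = (27 − 1)/2`.
* §4 (APPENDED 2026-08-22, o6-r1 GEN 15 ask (i)) STAB `AnalyticStabilityLawThree` — the successor of the withdrawn (AN): for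
  3-surjective `W ∈ O6` with `W[3]|G_{ℚ₃}` reducible and `j ≠ 0`, `a^s_k = φ(3^k)(ν^s_k − ℓ)` is EVENTUALLY CONSTANT in `k`
  (HELD-OUT P-AN5-STAB PASS: ST-1 101/103, ST-4 102/103 at the new step `3 → 4`); `analyticPos`; PROVED `nu_succ_of_analyticStability`.

References: K. Kato, Astérisque 295 (2004) Thm. 12.5 [Kato2004Asterisque]; M. Kurihara, Invent. Math. 149 (2002)
Prop. 1.2, Rem. 1.3 [Kurihara2002]; B. Mazur, J. Tate, Duke Math. J. 54 (1987) [MazurTate1987]; A. Lei, R. Pollack,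
N. Pratap, arXiv:2412.16629 §4.3 [LeiPollackPratap2024].
-/

set_option autoImplicit false

noncomputable section

open scoped Classical

open WeierstrassCurve Literature.NumberTheory.EllipticCurves
  Literature.NumberTheory.EllipticCurves.Rank1Residual
  Literature.NumberTheory.EllipticCurves.Rank1Residual.Typed
  Summit.BirchSwinnertonDyer.Rank1Residual.Additive

open Literature.NumberTheory.DiophantineGeometry (KodairaSymbol)

namespace Summit.BirchSwinnertonDyer.Rank1Residual.O6

/-! ## §1 The analytic minimum `a_min(shape, s, k)` -/

/-- **`a_min(shape, s, k)`** (memo §5 (AN)): `⌊(3^{k−1} − 1)/4⌋` for IRR (`2, 6, 20, 60` at `k = 3..6`), `1` on the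
`−s_T` side of ET1 / ORD1 (the side OPPOSITE to the rational 3-torsion), `0` otherwise. [folklore] -/
def analyticMin (S : LocalShapeThree) (s : Bool) (k : ℕ) : ℕ :=
  match S, S.torsSign with
  | .IRR, _ => irrFloor k
  | _, none => 0
  | _, some sT => if s = sT then 0 else 1

/-- Values: IRR at `k = 4` is `6`; ET1 on the odd side is `1`, on the even side `0`; ETM is `0`. [folklore] -/
theorem analyticMin_values :
    analyticMin .IRR true 4 = 6 ∧ analyticMin .ET1 false 3 = 1 ∧ analyticMin .ET1 true 3 = 0 ∧
      analyticMin .ORD1 true 3 = 1 ∧ analyticMin .ETM false 3 = 0 := by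
  decide

/-! ## §2 The analytic laws (A), (B), (AN) of T-O6-G12 (`@[conjecture]` nodes over `real` and `KatoIntegralAtThree`) -/

section Laws

variable (real : ∀ (W : WeierstrassCurve ℚ) [W.IsElliptic] [W.IsGloballyMinimal], SignedFloorDatum W → Prop)
variable (KatoIntegralAtThree : ∀ (W : WeierstrassCurve ℚ) [W.IsElliptic] [W.IsGloballyMinimal], Prop)

/-- **(A) the KATO BRIDGE KL-a `KatoLocalFloorBoundThree` (THEOREM-CANDIDATE conditional on Kato's integrality of the
zeta element of `W` at `3` — the interface hypothesis `KatoIntegralAtThree W`; `@[conjecture]` until a kernel proof;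
EVIDENCE-labelled).** For `W ∈ O6`, every `k ≥ 1` and sign `s`: if the `χ_s`-part of `θ_{k+1}(W)` is non-zero, of
valuation `ν^s_k(W)`, then `ν^s_k(W) ≥ 𝔪^s_k(W) − v₃(c_W)`. Route (memo gen 9–11): `𝔪^s_k = (k+1)/2 + min_{L_k^*}
v₃ R_{χ_s}` is by construction the least valuation `R_{χ_s}` takes on the dual lattice `L_k^* = exp*(H¹(K_k, T))`;
Kato's zeta element is integral up to `c_W` [Kato Thm 12.5] and its dual exponential gives `τ(χ̄)L(W,χ̄,1)/Ω` by the
explicit reciprocity law, so the `L`-value valuation is at least the floor minus `v₃(c_W)`. With (M): a PROVED lower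
bound `ν ≥ ½ + p(cell) − (2 + v₃c_W·φ)/φ(3^k)` cell-uniformly would follow. Why it might fail: only with the
integrality input at an additive prime (the `c_W` bookkeeping). HELD-OUT (GEN 10 restamp 1): P-AN4 clause AN-2
`ν ≥ 𝔪` 474/474 PASS on the 120 KF4 curves, `k ≤ 3` (o6-r1 GEN 13 §4) — supports (A) a fortiori.
[evidence: census cell O6, o6-r1 GEN 9–11: KL-a 0 violations / 1 262 (curve, k, sign) rows with the c_W-term 0; 𝔪 = ν on 799; control 17a1 (good ss): 𝔪⁺_2 = 𝔪⁺_3 = 1/3 = Kurihara's q_n/φ(3^n) exactly; 11a1 (ordinary): 𝔪 = 0]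
[cite: Kato2004Asterisque, Thm. 12.5 (pp. 221–222)] [cite: Kurihara2002, Prop. 1.2] -/
@[conjecture] def KatoLocalFloorBoundThree : Prop :=
  ∀ (W : WeierstrassCurve ℚ) [W.IsElliptic] [W.IsGloballyMinimal] (D : SignedFloorDatum W),
    ClassO6 W 3 → real W D → KatoIntegralAtThree W →
      ∀ (k : ℕ) (s : Bool) (v : ℚ), 1 ≤ k → D.nu k s = some v → D.floor k s - (D.katoConst : ℚ) ≤ v

/-- **(B) the REFINED-BSD / SELMER-LENGTH shape KL-b `SelmerLengthLawThree` (CONJECTURE, BSD-strength;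
EVIDENCE-labelled).** For `W ∈ O6`, `k ≥ 1`, sign `s`, non-vanishing `χ_s`-part: `φ(3^k)·(ν^s_k(W) − 𝔪^s_k(W))` is a
NON-NEGATIVE INTEGER — conjecturally the `𝒪_χ`-length of the `χ_s`-isotypic part of the 3-Selmer group of `W` over
`K_k` with the TRACE-FREE local condition at `3` (`P ∈ W(K_{k,𝔭}) ⊗ ℤ₃` with `Tr_{K_k/F_{k−1}} P ≡ 0`): "the analytic
`3`-adic valuation of `L(W,χ,1)/Ω` is the LOCAL floor plus a Selmer length" (Kurihara Rem. 1.3 / Mazur–Tate shape at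
a wild prime). The Selmer side is not part of the datum; only integrality and non-negativity are typed. Why it might
fail: a row with `ν < 𝔪` (KL-a allows it when `v₃(c_W) > 0`) or a non-integral deficit. Held-out test = P-AN4 clause
(pre-registered): "`φ(ν − 𝔪) ∈ ℤ_{≥0}` on 100 %, `= 0` on `≥ 50 %` per cell". HELD-OUT RESULT (GEN 10 restamp 1,
o6-r1 GEN 13 §4): AN-2 `φ(3^k)(ν − 𝔪) ≥ 0` **474/474 PASS** (120 KF4 curves, `k ≤ 3`); exactness AN-5 `d = 0` on 40 %
(expected ≥ 50 %; "sharpness is not a law" — the inequality is the typed content and it survives).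
[evidence: census cell O6, o6-r1 GEN 9–11: KL-b deficits φ(ν − 𝔪) ∈ (1/φ)·ℤ_{≥0}·φ on 1 262 / 1 262 rows — = 0 on 799, > 0 on 463; at k = 3 the deficit-1 mass (130 rows) is largely the torsion unit of (Λ): d = a − λ = 1 exactly where λ^{s_T} = −1 and a = 0 (62 rows)]
[cite: Kurihara2002, Rem. 1.3] [cite: MazurTate1987, §1] -/
@[conjecture] def SelmerLengthLawThree : Prop :=
  ∀ (W : WeierstrassCurve ℚ) [W.IsElliptic] [W.IsGloballyMinimal] (D : SignedFloorDatum W),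
    ClassO6 W 3 → real W D →
      ∀ (k : ℕ) (s : Bool) (v : ℚ), 1 ≤ k → D.nu k s = some v →
        ∃ d : ℕ, (phiThree k : ℚ) * (v - D.floor k s) = d

/-- **WITHDRAWN — REFUTED-AS-STATED on the pre-registered held-out P-AN4, clause AN-1 (o6-r1 GEN 13, scored
2026-08-21T21:16Z with the frozen scorer 2fd0355ab5aaeb4a): 10/474 signed rows have `a = −1` — 10098b1 (3,II) SPLIT `+`,
10530a1 (4,II) ET1 `+`, 10692f1 (5,II) ORD1 `−`, 11178b1 / 11178e1 (5,IV) ET1 `+`, at `k = 2, 3`, all on the torsion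
side `s_T` or SPLIT. Kept VERBATIM as a tombstone, no longer `@[conjecture]`; do not use; the repaired reading (`a ≥ −1`
on the `s_T` side of ET1/ORD1 and on SPLIT, `≥ 0` otherwise; 474/474 post-hoc) awaits o6-r1's gen-14 pre-registration and
is NOT typed.** Former (AN), the ANALYTIC CELL LAW C-O6-G12-AN (= (M)+(Λ)+(IRR)+(B) read on the analytic side): for `W ∈ O6`, `k ≥ 2`, sign `s`, non-vanishing `χ_s`-part:
`a^s_k(W) := φ(3^k)·(ν^s_k(W) − ℓ(v₃N, Kod₃))` is an INTEGER `≥ a_min(shape, s, k)` (`analyticMin`: `1` on the `−s_T`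
side of ET1/ORD1, `⌊(3^{k−1}−1)/4⌋` for IRR, `0` otherwise) — i.e. `v₃(L(W,χ,1)/Ω)` (gens 9–11 normalisation) `≥
ℓ(cell) + a_min/φ(3^k)` for EVERY `χ` of conductor `3^{k+1}`, `k ≥ 2`, with the cell constant `ℓ` and NO
curve-dependent loss; an EQUALITY on 77 % of the `k = 3` rows; the torsion dip `λ^{s_T} = −1` of the LOCAL floor is
never seen analytically. `a^s_k` is `k`-INDEPENDENT per curve from `k = 3` on outside IRR (515/528 from `3 → 4`); for
IRR `min_s a^s_k = ⌊A_k⌋` grows (one unit per layer). Why it might fail: a negative or non-integral `a`, or an IRR row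
below `⌊A_k⌋`; HELD-OUT test = P-AN4 on the 120 KF4 curves — RUN, KILL on AN-1 (above).
[evidence: census cell O6, o6-r1 GEN 10–12 exact θ-tables (gen12/an/nu_isl_k1-6.tsv a41343a2dcb2c5c4, 3 006 rows): a ∈ ℤ_{≥0} on 1 140/1 140 finite rows (k = 2,3) + 1 140/1 140 (k = 4,5) + 156/156 (k = 6, 78 curves N ≤ 800); k = 3 by shape: ETM/ORDM a = 0 on 216/250; ET1/ORD1 −s_T side a ≥ 1 116/116 (= 1 on 89), s_T side a ≥ 0; IRR a ≥ 2 42/42 (= 2 on 35); SPLIT a ∈ {0,1,3,10}; equality with a_min 438/570 = 77 %; ν ≥ max(ℓ, 𝔪) 1 140/1 140]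
[cite: LeiPollackPratap2024, §4.3 Ex. 4.8 and Conj. 4.11 (the p ≥ 5, e = 6 analogue)] -/
def AnalyticCellLawThree : Prop :=
  ∀ (W : WeierstrassCurve ℚ) [W.IsElliptic] [W.IsGloballyMinimal] (D : SignedFloorDatum W),
    ClassO6 W 3 → real W D →
      ∀ (k : ℕ) (s : Bool) (v : ℚ), 2 ≤ k → D.nu k s = some v →
        ∃ a : ℕ, analyticMin D.shape s k ≤ a ∧
          (phiThree k : ℚ) * (v - cellLevel (condExp W 3) (W.kodairaSymbolAt (placeOf 3))) = a

/-- WITHDRAWN — bookkeeping corollary of the refuted (AN) (`ν ≥ ℓ(cell)` at every `k ≥ 2`); vacuous record, do not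
use. [folklore] -/
@[deprecated "withdrawn: (AN) `AnalyticCellLawThree` was refuted-as-stated on o6-r1's pre-registered held-out P-AN4 (AN-1, 2026-08-21); repaired form awaits a gen-14 pre-registration" (since := "2026-08-21")]
theorem cellLevel_le_nu_of_analyticCellLaw (hAN : AnalyticCellLawThree real)
    (W : WeierstrassCurve ℚ) [W.IsElliptic] [W.IsGloballyMinimal] (D : SignedFloorDatum W) (hO : ClassO6 W 3)
    (hD : real W D) (k : ℕ) (s : Bool) (v : ℚ) (hk : 2 ≤ k) (hv : D.nu k s = some v) :
    cellLevel (condExp W 3) (W.kodairaSymbolAt (placeOf 3)) ≤ v := by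
  obtain ⟨a, -, ha⟩ := hAN W D hO hD k s v hk hv
  have hφ : (0 : ℚ) < phiThree k := by
    have : 0 < phiThree k := by unfold phiThree; positivity
    exact_mod_cast this
  have h0 : (0 : ℚ) ≤ (phiThree k : ℚ) * (v - cellLevel (condExp W 3) (W.kodairaSymbolAt (placeOf 3))) := by
    rw [ha]; exact_mod_cast Nat.zero_le a
  nlinarith

/-- (A) + (B): under Kato's integrality BOTH bounds hold, and (B) alone already gives `𝔪 ≤ ν` (bookkeeping: the
Selmer-length shape is the stronger, BSD-strength statement; (A) is the theorem-candidate). [folklore] -/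
theorem floor_le_nu_of_selmerLengthLaw (hB : SelmerLengthLawThree real)
    (W : WeierstrassCurve ℚ) [W.IsElliptic] [W.IsGloballyMinimal] (D : SignedFloorDatum W) (hO : ClassO6 W 3)
    (hD : real W D) (k : ℕ) (s : Bool) (v : ℚ) (hk : 1 ≤ k) (hv : D.nu k s = some v) :
    D.floor k s ≤ v := by
  obtain ⟨d, hd⟩ := hB W D hO hD k s v hk hv
  have hφ : (0 : ℚ) < phiThree k := by
    have : 0 < phiThree k := by unfold phiThree; positivity
    exact_mod_cast this
  have h0 : (0 : ℚ) ≤ (phiThree k : ℚ) * (v - D.floor k s) := by rw [hd]; exact_mod_cast Nat.zero_le d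
  nlinarith

end Laws

/-! ## §3 Worked rows of the memo (kernel arithmetic on `floorOf` / `lamOf`; census values, EVIDENCE only) -/

/-- Memo's sanity row: cell `(4, II*)`, `k = 3`, position `n = −16` ⇒ `𝔪 = 25/18` and `λ = +1` (an ORD1 curve on its
`−s_T = +` side). [folklore] -/
theorem workedRow_four_IIstar : floorOf (-16) 3 = 25 / 18 ∧ lamOf 4 .IIstar (-16) 3 = 1 := by
  constructor <;>
    norm_num [floorOf, lamOf, phiThree, newPoleOrder, sixNewPoleOrder, sixNewPoleOrderB]

/-- P-KF3's IRR prediction at `k = 4` on cell `(3, II)`: positions `n = −7` (sign `+`) and `−6` (sign `−`) give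
`λ = 7, 6`, summing to `(3³ − 1)/2 = 13` with the odd unit on `+`, both `≥ irrFloor 4 = 6`. [folklore] -/
theorem workedRow_irr_four :
    lamOf 3 .II (-7) 4 = 7 ∧ lamOf 3 .II (-6) 4 = 6 ∧
      lamOf 3 .II (-7) 4 + lamOf 3 .II (-6) 4 = ((3 ^ (4 - 1) - 1 : ℕ) : ℚ) / 2 ∧ (irrFloor 4 : ℚ) = 6 := by
  refine ⟨?_, ?_, ?_, ?_⟩ <;>
    norm_num [lamOf, phiThree, newPoleOrder, sixNewPoleOrder, sixNewPoleOrderA, irrFloor]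

/-! ## §4 STAB — the ANALYTIC STABILITY LAW (o6-r1 GEN 15; successor of the withdrawn (AN); HELD-OUT P-AN5-STAB = PASS)

APPEND-ONLY addition (cc-typer-5 GEN 10, 2026-08-22; ask of o6-r1 GEN 15, `HOME/INBOX.md` 2026-08-22T00:10Z (i) and memo
`HOME/b2b-bsdres-o6-r1/gen15/O6-GEN15.md` §0 (iii), §3, §5; pre-registration `gen15/an5/PAN5STAB-PREREG.md` 394bc06dfd87a8ec written
BEFORE any KF5 `ν` with `k ≥ 2` was read, frozen scorer `pan5stab.py` 3da8bac2bc62539c). Everything above this section is byte-identical. -/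

section Stability

variable (real : ∀ (W : WeierstrassCurve ℚ) [W.IsElliptic] [W.IsGloballyMinimal], SignedFloorDatum W → Prop)

/-- The ANALYTIC POSITION `a^s_k := φ(3^k)·(ν^s_k − ℓ(v₃N, Kod₃))` of a finite `χ_s`-valuation `ν` at level `k` (gen 12's `a`;
`ℓ = cellLevel`). [folklore] -/
def analyticPos (W : WeierstrassCurve ℚ) [W.IsElliptic] (k : ℕ) (v : ℚ) : ℚ :=
  (phiThree k : ℚ) * (v - cellLevel (condExp W 3) (W.kodairaSymbolAt (placeOf 3)))

/-- **STAB `AnalyticStabilityLawThree` (CONJECTURE; KILLABLE; EVIDENCE-labelled; o6-r1 GEN 15 — the successor of the WITHDRAWN (AN):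
it keeps (AN)'s `k`-independence and DROPS its refuted level inequality `a ≥ 0`).** For `W ∈ O6` with SURJECTIVE mod-3 image,
`W[3]|G_{ℚ₃}` REDUCIBLE (shape ≠ IRR) and `j(W) ≠ 0`, the analytic position `a^s_k(W)` is EVENTUALLY CONSTANT in `k` on each sign:
there is a `k₀` such that for all `k ≥ k₀`, whenever the `χ_s`-parts at levels `k` and `k+1` are both non-zero,
`φ(3^{k+1})(ν^s_{k+1} − ℓ) = φ(3^k)(ν^s_k − ℓ)` — in closed form `φ(3^k)·ν^s_k(W) = (2ℓ(τ)/3)·3^k + b^s(W)` for `k ≥ k₀`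
(`φ(3^k)·ℓ = (2ℓ/3)·3^k`). No sign is asserted for `b^s` (rows with `a = −1` exist: the five P-AN4 witnesses). TYPER DECISION
(cc-typer-5 GEN 10; open to o6-r1's objection): o6-r1's scored clause is the SHARP form "`k₀ ≤ 3`" (ST-1 / ST-4: `a_3 = a_4` on
≥ 95 %); as a universal statement that sharp form has FOUR named exceptions with the instrument OK — island 5427d1 / 5427e1 and KF5
12960i1 / 12960j1 ((4,IV) ETM, `s = +`, `a = 1, 3, 11`), all read as `k₀ = 4` ("watch at `k = 5`") — so the node asserts EVENTUAL
constancy (the law), and "`k₀ ≤ 3` on 98–99 % of 3-surjective reducible `j ≠ 0` curves" is recorded as EVIDENCE, not typed. NOT typed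
either (memo §5: "exploratory shells, NOT conjecture-grade"): the IRR step form `a_4 − a_3 = 9/2 + 2c ∈ {4, 6, 8, …}` and the CM / Borel
one-sign form E-ISOG (`a^{s₀}_k = 3^{k−1−e} + b`). Why it might fail: a 3-surjective, locally reducible, `j ≠ 0` curve of O6 whose
`a^s_k` never stabilises (e.g. grows by a μ-type slope on one sign, as the Borel / CM rows do) — one such curve with the instrument
OK refutes it. With STAB + the local tower laws (D), (C) + 3-BSD over `k_n`, the Ш-growth law (G) `e_n = α·3^n + β + γn + δ(−1)^n`
follows (memo §2.3) — (G) is NOT typed as an independent node.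
[evidence: census cell O6, o6-r1 GEN 12/15: island (285 curves, exact θ-tables) a^s_3 = a^s_4 on 495/498 reducible signed rows; HELD-OUT P-AN5-STAB on KF5 (109 3-surjective curves, N ∈ (12150, 15795], k ≤ 4; scorer 3da8bac2bc62539c): ST-int 240/240, ST-1 (s = +) 101/103 = 98.1 % PASS, ST-4 (s = −) 102/103 = 99.0 % PASS, ST-2/2− (a_2 = a_3 = a_4) 84.5 % / 82.5 % WEAK (k₀ = 3 rows), verdict PASS; exceptions named above]
[cite: Kurihara2002, Prop. 1.2] [cite: Pollack2003, §5 (e_n = e_{n−1} + q_n)] -/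
@[conjecture] def AnalyticStabilityLawThree : Prop :=
  ∀ (W : WeierstrassCurve ℚ) [W.IsElliptic] [W.IsGloballyMinimal] (D : SignedFloorDatum W),
    ClassO6 W 3 → real W D → W.HasSurjectiveModNGaloisRep 3 → D.shape ≠ .IRR → W.j ≠ 0 →
      ∀ s : Bool, ∃ k₀ : ℕ, ∀ (k : ℕ) (v v' : ℚ), k₀ ≤ k → D.nu k s = some v → D.nu (k + 1) s = some v' →
        analyticPos W (k + 1) v' = analyticPos W k v

/-- Bookkeeping (PROVED): under STAB, from the stabilisation level on (and `k ≥ 1`), consecutive finite valuations determine each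
other — `ν^s_{k+1} − ℓ = (ν^s_k − ℓ)/3` (since `φ(3^{k+1}) = 3·φ(3^k)`): the analytic valuation approaches the cell level
geometrically. [folklore] -/
theorem nu_succ_of_analyticStability (hS : AnalyticStabilityLawThree real)
    (W : WeierstrassCurve ℚ) [W.IsElliptic] [W.IsGloballyMinimal] (D : SignedFloorDatum W) (hO : ClassO6 W 3)
    (hD : real W D) (hsurj : W.HasSurjectiveModNGaloisRep 3) (hred : D.shape ≠ .IRR) (hj : W.j ≠ 0) (s : Bool) :
    ∃ k₀ : ℕ, ∀ (k : ℕ) (v v' : ℚ), k₀ ≤ k → D.nu k s = some v → D.nu (k + 1) s = some v' →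
      v' - cellLevel (condExp W 3) (W.kodairaSymbolAt (placeOf 3)) =
        (v - cellLevel (condExp W 3) (W.kodairaSymbolAt (placeOf 3))) / 3 := by
  obtain ⟨k₀, hk₀⟩ := hS W D hO hD hsurj hred hj s
  refine ⟨max k₀ 1, fun k v v' hk hv hv' => ?_⟩
  have hk1 : 1 ≤ k := le_trans (le_max_right _ _) hk
  have h := hk₀ k v v' (le_trans (le_max_left _ _) hk) hv hv'
  unfold analyticPos at h
  have hφ : (phiThree (k + 1) : ℚ) = 3 * phiThree k := by
    obtain ⟨m, rfl⟩ : ∃ m, k = m + 1 := ⟨k - 1, by omega⟩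
    unfold phiThree
    push_cast
    simp [pow_succ]
    ring
  have hpos : (0 : ℚ) < phiThree k := by
    have : 0 < phiThree k := by unfold phiThree; positivity
    exact_mod_cast this
  rw [hφ] at h
  have h' : (phiThree k : ℚ) * ((v' - cellLevel (condExp W 3) (W.kodairaSymbolAt (placeOf 3))) * 3) =
      (phiThree k : ℚ) * (v - cellLevel (condExp W 3) (W.kodairaSymbolAt (placeOf 3))) := by
    rw [← h]; ring
  exact (eq_div_iff three_ne_zero).2 (mul_left_cancel₀ hpos.ne' h')

end Stability

end Summit.BirchSwinnertonDyer.Rank1Residual.O6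

end
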